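import Literature.NumberTheory.Automorphic.Liu2021.Def45AsPrinted
import Literature.NumberTheory.DiophantineGeometry.AVIsogenyTateFreeHomProofs
import Literature.AlgebraicGeometry.Motives.AbelianVarietyEndAlgebraSemisimpleProofs
import HarnessLib

/-!
# [Liu 2021] Definition 4.5 (2) — the data readings `{A_μ, i_μ, [M_μ:ℚ] = 2 dim A_μ, first bullet}` are NOT
# satisfiable by a degenerate (zero / scalar) datum

Y. Liu, *Fourier–Jacobi cycles and arithmetic relative trace formula*, Camb. J. Math. **9** (2021) =
arXiv:2102.11518 [Liu2021], `FJcycle.tex` Def. 4.5 = `de:cm_data`, ll. 1936–1964; companion THEOREM file of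
`Liu2021/Def45AsPrinted` (item6-p1) and `Liu2021/Def45RationalCheck` (audit point (R2)).  Written for the red-team
vacuity audit of the cells pub-hodgecm / pub-hodgecm2 (`hodge-director/AUDIT-VACUITY-2.md` DELTA 7, 2026-08-21,
open item «whether `{i, hdim, hdet45}` is satisfiable at a DEGENERATE `A_μ` (scalar / zero datum)» — the binders by
which `Transposition/Item6PinMatchDef45.lean` (`Model.hCMisogE_of_det45`) replaced the binder `hCMisogE`).

ANSWER (kernel theorems, no hypothesis beyond the data readings themselves).  Let `E` be a CM number field,
`μ` conjugate symplectic (so Liu's value field `M_μ = muAlgValueField E μ ⊆ ℂ` is a NUMBER FIELD,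
`IsConjugateSymplectic.numberField_muAlgValueField`, [Liu2021] §4.1 l. 1928), `A / E` an abelian variety and
`i : M_μ →+* End⁰(A)` a ring homomorphism with `[M_μ : ℚ] = 2 dim A` (the reading `hdim` = `CMDatum.finrank_eq` of
«`i_μ` is a CM structure», l. 1948).  Then:

* `Def45.dim_pos_of_finrank_eq` — **`0 < dim A`**: the ZERO abelian variety is excluded (`[M_μ:ℚ] ≥ 1`, so
  `2 dim A ≥ 1`); `Def45.two_le_finrank_of_finrank_eq` — hence `[M_μ : ℚ] ≥ 2`.
* `Def45.nontrivial_endAlgebra_of_dim_pos` — for ANY abelian variety of positive dimension over a field of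
  characteristic `0`, `End⁰(A) = ℚ ⊗ End A` is a non-trivial ring: `(𝟙_A)^* = id ≠ 0 = 0^*` on the `dim A`-dimensional
  cotangent space `𝔪_e/𝔪_e²` (b11's `AbelianVariety.cotangentMap_id/_zero`, `finrank_cotangent`; Görtz–Wedhorn II
  Rem. 27.18, Prop. 27.20), so `𝟙_A ≠ 0` in `End A`, and `End A ↪ End⁰ A` in characteristic `0` (Mumford §19 Thm. 3,
  the tree's `endAlgebra.of_injective_of_charZero`).
* `Def45.injective_of_finrank_eq` — **`i` is INJECTIVE** (a ring map out of a field into a non-trivial ring):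
  `i(M_μ) ≅ M_μ` is a subfield of `End⁰(A)` of degree `2 dim A` over `ℚ` (`Def45.finrank_range_eq`).
* `Def45.exists_apply_not_mem_range_algebraMap` — **the SCALAR datum is excluded**: some `i(x)` lies outside
  `ℚ · 1 ⊆ End⁰(A)` (else `i = algebraMap ∘ c` for a map `c : M_μ → ℚ` which is forced `ℚ`-linear and injective,
  so `[M_μ:ℚ] ≤ 1`).
* `Def45.exists_presentation` / `CMDatum.exists_det_cotangentMap_eq` — the FIRST BULLET (l. 1950, `CMDatum.det45`,
  READING I1-R4: «for every presentation `i(x) = M⁻¹ · (1 ⊗ f)`, `det(f^* | 𝔪_e/𝔪_e²) = M^{dim A} η_μ(x)`») is NOT a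
  vacuous `∀`: EVERY `x ∈ M_μ` HAS a presentation (normal form in `ℚ ⊗ End A`, `endAlgebra.exists_eq_algebraMap_mul_of`),
  so `det45` pins, for every `x`, the determinant of an actual endomorphism `f ∈ End A` on the non-zero space `𝔪_e/𝔪_e²`.
* `Def45.CMDatum.dim_pos`, `.two_le_finrank`, `.nontrivial_endAlgebra`, `.i_injective`, `.finrank_range_i`,
  `.exists_i_not_mem_range_algebraMap`, `.exists_det_cotangentMap_eq` — the same for an as-printed datum
  `D : Def45.CMDatum φ ι hμ hw C` (item6-p1's structure), through its fields `A`, `i`, `finrank_eq`, `det45` only.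

So on the lane `hCMisogE ↦ {Aμ₀, iμ₀, hdim, hdet45}` the two DATA binders cannot be met by `A_μ = 0` or by a scalar
structure: at every face where `hdim` is supplied, `A_μ` has dimension `[M_μ:ℚ]/2 ≥ 1` and `i_μ` embeds the CM field
`M_μ` into `End⁰(A_μ)`; what the binders ask for is exactly an abelian variety over `E` with complex multiplication by
`M_μ` whose cotangent determinant character is Liu's `η_μ` — the content of [Liu2021] Prop. 4.6 (1) («`𝒜(μ)` is
non-empty», l. 1969), which is NOT asserted here or anywhere in the tree.  (The complementary check that `det45` adds
no condition on the rational line `ℚ ⊆ M_μ` is `Def45RationalCheck`.)  Theorems only; no definition, no named fact,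
no `sorry`; nothing about [Liu2021] is asserted beyond `Def45AsPrinted`.  FRAMING: HC_CM is NOT proved; this file
discharges no binder of any cell display.

## References
* [Liu2021] Y. Liu, arXiv:2102.11518, §4.1 l. 1928 (`M_μ` a number field), Def. 4.5 (2) (ll. 1944–1951),
  Prop. 4.6 (1) (l. 1969).
* [MumfordAV1970] D. Mumford, *Abelian Varieties* (1970), §19 Thm. 3 and "The structure of `End⁰(X)`" (p. 176).
* [GortzWedhorn2023] U. Görtz, T. Wedhorn, *Algebraic Geometry II* (2023), Rem. 27.18 (1),(3) (pp. 805–806),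
  Prop. 27.20 (p. 806).
-/

set_option autoImplicit false

noncomputable section

open NumberField
open Literature.AlgebraicGeometry.Motives (AbelianVariety)
open Literature.AlgebraicGeometry.Motives
open Literature.NumberTheory.ComplexMultiplication

universe u

namespace Literature.NumberTheory.Automorphic.Liu2021

namespace Def45

/-! ## `End⁰(A)` is non-trivial for `dim A > 0` (any ground field of characteristic `0`) -/

section EndAlgebra

open CategoryTheory

variable {K : Type u} [Field K] (A : AbelianVariety K)

/-- The cotangent space `𝔪_e/𝔪_e²` of an abelian variety of positive dimension is a non-zero vector space
(`dim_K 𝔪_e/𝔪_e² = dim A`, b11's `AbelianVariety.finrank_cotangent`). [cite: GortzWedhorn2023, Prop. 27.20 (p. 806)] -/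
theorem nontrivial_cotangent_of_dim_pos (h : 0 < A.dim) : Nontrivial (AbelianVariety.Cotangent A) := by
  apply Module.nontrivial_of_finrank_pos (R := K)
  rw [AbelianVariety.finrank_cotangent]
  exact h

/-- **`𝟙_A ≠ 0` in `End A` when `dim A > 0`**: `(𝟙_A)^* = id` and `0^* = 0` on the non-zero cotangent space
(`AbelianVariety.cotangentMap_id`, `cotangentMap_zero`). [cite: GortzWedhorn2023, Rem. 27.18 (1) and (3) (pp. 805–806)] -/
theorem id_ne_zero_of_dim_pos (h : 0 < A.dim) : (𝟙 A : A ⟶ A) ≠ 0 := by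
  intro h0
  haveI := nontrivial_cotangent_of_dim_pos A h
  have h1 := congrArg (AbelianVariety.cotangentMap A) h0
  rw [AbelianVariety.cotangentMap_id, AbelianVariety.cotangentMap_zero] at h1
  obtain ⟨v, hv⟩ := exists_ne (0 : AbelianVariety.Cotangent A)
  exact hv (by simpa using LinearMap.congr_fun h1 v)

/-- The endomorphism RING `End A` of an abelian variety of positive dimension is non-trivial (`1 = 𝟙_A ≠ 0`).
[cite: GortzWedhorn2023, Rem. 27.18 (1) and (3) (pp. 805–806)] -/
theorem nontrivial_end_of_dim_pos (h : 0 < A.dim) : Nontrivial (End A) :=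
  ⟨⟨1, 0, by rw [End.one_def]; exact id_ne_zero_of_dim_pos A h⟩⟩

/-- **`End⁰(A) = ℚ ⊗_ℤ End A` is a non-trivial ring for `dim A > 0` in characteristic `0`**: `End A` is non-trivial
(`nontrivial_end_of_dim_pos`) and `End A → End⁰ A`, `f ↦ 1 ⊗ f`, is injective (`End A` torsion-free, Mumford §19
Thm. 3; the tree's `AbelianVariety.endAlgebra.of_injective_of_charZero`). [cite: MumfordAV1970, §19 Thm. 3 and "The structure of End⁰(X)" (p. 176)] -/
theorem nontrivial_endAlgebra_of_dim_pos [CharZero K] (h : 0 < A.dim) : Nontrivial A.endAlgebra := by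
  haveI := nontrivial_end_of_dim_pos A h
  exact (AbelianVariety.endAlgebra.of_injective_of_charZero (A := A)).nontrivial

/-- Normal form, recorded in the currency of `CMDatum.det45`: every element of `End⁰(A)` HAS a presentation
`M⁻¹ · (1 ⊗ f)` with `M ≠ 0`, `f ∈ End A` (the tree's `endAlgebra.exists_eq_algebraMap_mul_of`) — so a hypothesis
quantified over all presentations of an element is never vacuous. [cite: MumfordAV1970, §19 "The structure of End⁰(X)" (p. 176)] -/
theorem exists_presentation (x : A.endAlgebra) :
    ∃ (M : ℕ) (f : End A), M ≠ 0 ∧ x = algebraMap ℚ A.endAlgebra (M : ℚ)⁻¹ * AbelianVariety.endAlgebra.of A f :=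
  AbelianVariety.endAlgebra.exists_eq_algebraMap_mul_of x

end EndAlgebra

/-! ## The readings `(A, i, [M_μ:ℚ] = 2 dim A)` exclude the zero and the scalar datum -/

section Unbundled

variable {E : Type} [Field E] [NumberField E] [IsCMField E]
variable {μ : IdeleClassGroup E →ₜ* Circle} (hμ : IdeleClassGroup.IsConjugateSymplectic E μ)
variable (A : AbelianVariety E) (i : IdeleClassGroup.muAlgValueField E μ →+* A.endAlgebra)

include hμ

/-- **The zero datum is excluded**: if `[M_μ : ℚ] = 2 dim A` then `0 < dim A`, because `M_μ` is a number field
([Liu2021] §4.1 l. 1928; `IsConjugateSymplectic.numberField_muAlgValueField`), so `[M_μ : ℚ] ≥ 1`.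
[cite: Liu2021, §4.1 l. 1928 and Def. 4.5 (2) (l. 1948)] -/
theorem dim_pos_of_finrank_eq (hdim : Module.finrank ℚ (IdeleClassGroup.muAlgValueField E μ) = 2 * A.dim) :
    0 < A.dim := by
  haveI := hμ.numberField_muAlgValueField
  have hpos : 0 < Module.finrank ℚ (IdeleClassGroup.muAlgValueField E μ) := Module.finrank_pos
  omega

/-- With `[M_μ : ℚ] = 2 dim A`, in fact `2 ≤ [M_μ : ℚ]`. [cite: Liu2021, §4.1 l. 1928 and Def. 4.5 (2) (l. 1948)] -/
theorem two_le_finrank_of_finrank_eq (hdim : Module.finrank ℚ (IdeleClassGroup.muAlgValueField E μ) = 2 * A.dim) :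
    2 ≤ Module.finrank ℚ (IdeleClassGroup.muAlgValueField E μ) := by
  have := dim_pos_of_finrank_eq hμ A hdim
  omega

/-- Under `[M_μ : ℚ] = 2 dim A` the ring `End⁰(A)` is non-trivial (positive dimension, characteristic `0`).
[cite: MumfordAV1970, §19 Thm. 3 and "The structure of End⁰(X)" (p. 176)] -/
theorem nontrivial_endAlgebra_of_finrank_eq
    (hdim : Module.finrank ℚ (IdeleClassGroup.muAlgValueField E μ) = 2 * A.dim) : Nontrivial A.endAlgebra :=
  nontrivial_endAlgebra_of_dim_pos A (dim_pos_of_finrank_eq hμ A hdim)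

/-- **`i : M_μ → End⁰(A)` is injective** under `[M_μ : ℚ] = 2 dim A` (READING I1-R3 of `Def45AsPrinted`: «a ring map
out of a field is injective» — into a NON-TRIVIAL ring, which `End⁰(A)` is by `dim A > 0`).
[cite: Liu2021, Def. 4.5 (2) (l. 1948)] -/
theorem injective_of_finrank_eq (hdim : Module.finrank ℚ (IdeleClassGroup.muAlgValueField E μ) = 2 * A.dim) :
    Function.Injective i := by
  haveI := nontrivial_endAlgebra_of_finrank_eq hμ A hdim
  exact i.injective

/-- The image `i(M_μ) ⊆ End⁰(A)` has `ℚ`-dimension `[M_μ : ℚ] = 2 dim A` (injectivity).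
[cite: Liu2021, Def. 4.5 (2) (l. 1948)] -/
theorem finrank_range_eq (hdim : Module.finrank ℚ (IdeleClassGroup.muAlgValueField E μ) = 2 * A.dim) :
    Module.finrank ℚ (LinearMap.range i.toRatAlgHom.toLinearMap) = 2 * A.dim := by
  rw [← hdim]
  exact LinearMap.finrank_range_of_inj (fun x y hxy => injective_of_finrank_eq hμ A i hdim hxy)

/-- **The scalar datum is excluded**: under `[M_μ : ℚ] = 2 dim A`, NOT every `i(x)` is a rational scalar — some
`i(x) ∉ ℚ · 1 ⊆ End⁰(A)`.  Otherwise `i = algebraMap ∘ c` with `c : M_μ → ℚ`; as `algebraMap : ℚ → End⁰(A)` is injective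
(`End⁰(A)` non-trivial), `c` is additive, multiplicative, `ℚ`-linear and injective — an injective `ℚ`-linear map of the
`[M_μ:ℚ] ≥ 2`-dimensional `M_μ` into `ℚ`, impossible. [cite: Liu2021, Def. 4.5 (2) (l. 1948)] -/
theorem exists_apply_not_mem_range_algebraMap
    (hdim : Module.finrank ℚ (IdeleClassGroup.muAlgValueField E μ) = 2 * A.dim) :
    ∃ x : IdeleClassGroup.muAlgValueField E μ, i x ∉ Set.range (algebraMap ℚ A.endAlgebra) := by
  haveI := hμ.numberField_muAlgValueField
  haveI := nontrivial_endAlgebra_of_finrank_eq hμ A hdim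
  by_contra h
  push Not at h
  simp only [Set.mem_range] at h
  -- `i = algebraMap ∘ c` for a function `c : M_μ → ℚ`, forced `ℚ`-linear and injective
  choose c hc using h
  have hinj : Function.Injective (algebraMap ℚ A.endAlgebra) := (algebraMap ℚ A.endAlgebra).injective
  have hci : ∀ q : ℚ, c (algebraMap ℚ _ q) = q := fun q =>
    hinj (by rw [hc]; exact i.toRatAlgHom.commutes q)
  have hadd : ∀ x y, c (x + y) = c x + c y := fun x y =>
    hinj (by rw [hc, map_add, map_add, hc, hc])
  have hmul : ∀ x y, c (x * y) = c x * c y := fun x y =>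
    hinj (by rw [hc, map_mul, map_mul, hc, hc])
  let cL : IdeleClassGroup.muAlgValueField E μ →ₗ[ℚ] ℚ :=
    { toFun := c
      map_add' := hadd
      map_smul' := fun q x => by
        rw [Algebra.smul_def, hmul, hci, RingHom.id_apply, smul_eq_mul] }
  have hcL : Function.Injective cL := fun x y hxy => by
    apply injective_of_finrank_eq hμ A i hdim
    rw [← hc x, ← hc y]
    exact congrArg (algebraMap ℚ A.endAlgebra) hxy
  have h1 := LinearMap.finrank_le_finrank_of_injective hcL
  rw [Module.finrank_self] at h1
  have h2 := two_le_finrank_of_finrank_eq hμ A hdim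
  omega

end Unbundled

/-! ## The same for an as-printed datum `D_μ = (A_μ, i_μ, λ_μ, r_μ)` (`Def45.CMDatum`) -/

namespace CMDatum

variable {E : Type} [Field E] [NumberField E] [IsCMField E]
variable {L : Type} [Field L] [NumberField L] [IsGalois ℚ L] {φ : E →ₐ[ℚ] L} {ι : L →+* ℂ}
variable {μ : IdeleClassGroup E →ₜ* Circle} {hμ : IdeleClassGroup.IsConjugateSymplectic E μ}
variable {hw : IdeleClassGroup.HasWeight E μ 1} {C : Carriers E μ}

/-- **A CM datum has `dim A_μ > 0`** — the zero abelian variety carries no CM structure by the number field `M_μ`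
(`finrank_eq`). [cite: Liu2021, Def. 4.5 (2) (ll. 1946–1948)] -/
theorem dim_pos (D : CMDatum φ ι hμ hw C) : 0 < D.A.dim :=
  dim_pos_of_finrank_eq hμ D.A D.finrank_eq

/-- For a CM datum, `2 ≤ [M_μ : ℚ]`. [cite: Liu2021, Def. 4.5 (2) (l. 1948)] -/
theorem two_le_finrank (D : CMDatum φ ι hμ hw C) : 2 ≤ Module.finrank ℚ (IdeleClassGroup.muAlgValueField E μ) :=
  two_le_finrank_of_finrank_eq hμ D.A D.finrank_eq

/-- For a CM datum, `End⁰(A_μ)` is a non-trivial ring. [cite: Liu2021, Def. 4.5 (2) (ll. 1946–1948)] -/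
theorem nontrivial_endAlgebra (D : CMDatum φ ι hμ hw C) : Nontrivial D.A.endAlgebra :=
  nontrivial_endAlgebra_of_finrank_eq hμ D.A D.finrank_eq

/-- **For a CM datum, `i_μ : M_μ → End⁰(A_μ)` is injective** (a CM structure is an EMBEDDING of the CM field `M_μ`;
READING I1-R3). [cite: Liu2021, Def. 4.5 (2) (l. 1948)] -/
theorem i_injective (D : CMDatum φ ι hμ hw C) : Function.Injective D.i :=
  injective_of_finrank_eq hμ D.A D.i D.finrank_eq

/-- For a CM datum, `dim_ℚ i_μ(M_μ) = 2 dim A_μ`. [cite: Liu2021, Def. 4.5 (2) (l. 1948)] -/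
theorem finrank_range_i (D : CMDatum φ ι hμ hw C) : Module.finrank ℚ (LinearMap.range D.i.toRatAlgHom.toLinearMap) = 2 * D.A.dim :=
  finrank_range_eq hμ D.A D.i D.finrank_eq

/-- **A CM datum is not scalar**: some `i_μ(x)` is not in `ℚ · 1 ⊆ End⁰(A_μ)`. [cite: Liu2021, Def. 4.5 (2) (l. 1948)] -/
theorem exists_i_not_mem_range_algebraMap (D : CMDatum φ ι hμ hw C) :
    ∃ x : IdeleClassGroup.muAlgValueField E μ, D.i x ∉ Set.range (algebraMap ℚ D.A.endAlgebra) :=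
  exists_apply_not_mem_range_algebraMap hμ D.A D.i D.finrank_eq

/-- **The first bullet binds at every `x`**: for every `x ∈ M_μ` there IS a presentation `i_μ(x) = M⁻¹ · (1 ⊗ f)`,
and for it `det(f^* | 𝔪_e/𝔪_e²) = M^{dim A_μ} · η_μ(x)` (`det45`); the cotangent space is non-zero (`dim_pos`,
`nontrivial_cotangent_of_dim_pos`).  So `det45` is a condition on actual endomorphisms of `A_μ`, never an empty `∀`.
[cite: Liu2021, Def. 4.5 (2) (l. 1950)] -/
theorem exists_det_cotangentMap_eq (D : CMDatum φ ι hμ hw C) (x : IdeleClassGroup.muAlgValueField E μ) :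
    ∃ (M : ℕ) (f : CategoryTheory.End D.A), M ≠ 0 ∧
      D.i x = algebraMap ℚ D.A.endAlgebra (M : ℚ)⁻¹ * AbelianVariety.endAlgebra.of D.A f ∧
      LinearMap.det (AbelianVariety.cotangentMap D.A f) = (M : E) ^ D.A.dim * eta φ ι hμ x := by
  obtain ⟨M, f, hM, hx⟩ := exists_presentation D.A (D.i x)
  exact ⟨M, f, hM, hx, D.det45 x M f hM hx⟩

/-- The cotangent space `Lie_E(A_μ)^∨ = 𝔪_e/𝔪_e²` of a CM datum is non-zero. [cite: Liu2021, Def. 4.5 (2) (ll. 1946–1950)] -/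
theorem nontrivial_cotangent (D : CMDatum φ ι hμ hw C) : Nontrivial (AbelianVariety.Cotangent D.A) :=
  nontrivial_cotangent_of_dim_pos D.A D.dim_pos

end CMDatum

end Def45

end Literature.NumberTheory.Automorphic.Liu2021

end
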